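import Mathlib.Analysis.Convex.Segment
import Mathlib.Analysis.Convex.Basic
import Literature.Analysis.FluidPDE.StationaryEulerStates
import HarnessLib

/-!
# Laminates of finite order and the lamination convex hull for the stationary Euler inclusion
(Choffrut–Székelyhidi 2014, Def. 5, Def. 8, Lemma 9)

Topic `Literature/Analysis/FluidPDE`. Second support file of the proof of
`Literature.Analysis.FluidPDE.Torus.ChoffrutSzekelyhidi2014_thm1` (Choffrut–Székelyhidi, SIAM
J. Math. Anal. 46 (2014) = arXiv:1401.4301). Finite-dimensional combinatorics of §3:

* **laminates of finite order** (Def. 5; Müller–Šverák's "laminates of finite order",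
  Kirchheim's "prelaminates"), encoded as binary *splitting trees* `Laminate d`: a leaf
  `atom w` is a Dirac mass, a node `split t η q l r` is the measure `t ν_l + (1 - t) ν_r`
  obtained by splitting the barycentre `t z_l + (1 - t) z_r` along the segment `[z_l, z_r]`,
  together with the wave-cone certificate `(η, q)` of the direction `z_r - z_l` ((3.1) of the
  paper: `v̄ · η = 0`, `(ū + q Id) η = 0`). The class `𝓛(𝒰)` of Def. 5 is `IsValid 𝒰`
  (weights in `[0, 1]`, certified directions, splitting segments inside `𝒰`, atoms in `𝒰`);
  expectations `moment`, the barycentre `bary`, the atoms predicate `AllAtoms`, the variance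
  `var` with the parallel-axis identity, and grafting of trees onto atoms (`bind`) — the
  "closed under splitting" clause of Def. 5;
* the **gain of a laminate supported on `𝒦_{r'}`**: `∫ |w - w̄|² dν ≥ r' - |v̄|²` (proof of
  Cor. 16 of the paper: `∫ |z - z₀|² dν = r' - |z₀|²` for the velocity part);
* the **lamination convex hull** `lcHull 𝒰 = ⋃ᵢ 𝒰⁽ⁱ⁾` (Def. 8) and **Lemma 9**: the hull of a
  (relatively) open set is (relatively) open, and each of its points is the barycentre of a
  laminate of finite order valid in the hull with atoms in `𝒰`;
* the interface `RelaxedFamily` through which the two geometric constructions (§4, `d ≥ 3`;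
  §5, `d = 2`) feed the analytic part: a family of relatively open sets `𝒰_r ⊆ 𝒦_r^{co}` with
  property (*) `𝒦_{r'} ⊆ 𝒰_r` (`r' < r`) and the laminate property of Prop. 15 (iii)
  (every point of `𝒰_r` is the barycentre of a laminate in `𝓛(𝒰_r)` supported in `𝒦_{r'}`,
  `r' ∈ (r - ε, r)`), which by Prop. 7 / Cor. 16 implies the perturbation property (P).

"Open" is relative to the subspace of admissible states (`u` symmetric trace free), the paper's
state space `ℝ^d × 𝒮^d_0`, which we keep as the subset `Adm` of the ambient coordinate space.

## References

* A. Choffrut, L. Székelyhidi Jr., *Weak solutions to the stationary incompressible Euler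
  equations*, SIAM J. Math. Anal. 46 (2014), §3: Def. 5, Prop. 6–7, Def. 8, Lemma 9; §5,
  Prop. 15 (iii), Cor. 16.
* S. Müller, V. Šverák, *Convex integration for Lipschitz mappings and counterexamples to
  regularity*, Ann. of Math. 157 (2003), §2 (laminates of finite order).
-/

noncomputable section

open scoped InnerProductSpace Matrix

namespace Literature.Analysis.FluidPDE

namespace StationaryEuler

variable {d : Type*} [Fintype d] [DecidableEq d]

/-! ## Admissible states as a set -/

/-- The set of admissible states `ℝ^d × 𝒮^d_0` (symmetric trace-free stress).
[cite: ChoffrutSzekelyhidi2014, §2] -/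
def Adm : Set (State d) := {w | IsAdm w}

omit [DecidableEq d] in
/-- Membership in `Adm`. [folklore] -/
@[simp] theorem mem_Adm {w : State d} : w ∈ Adm ↔ IsAdm w := Iff.rfl

omit [DecidableEq d] in
/-- `Adm` is convex (it is a linear subspace). [folklore] -/
theorem convex_Adm : Convex ℝ (Adm : Set (State d)) := by
  intro w hw w' hw' a b _ _ _
  exact (IsAdm.smul hw a).add (IsAdm.smul hw' b)

/-- A set is *relatively open* (open in the subspace `Adm` of admissible states): around each
of its points it contains all nearby admissible states. [folklore] -/
def IsRelOpen (S : Set (State d)) : Prop :=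
  ∀ w ∈ S, ∃ ε > 0, ∀ w', IsAdm w' → dist w' w < ε → w' ∈ S

/-! ## Laminates of finite order as splitting trees -/

variable (d) in
/-- Laminates of finite order (Def. 5 of the paper) as binary splitting trees: `atom w` is the
Dirac mass `δ_w`; `split t η q l r` is `t ν_l + (1 - t) ν_r`, the splitting of the barycentre
`t z_l + (1 - t) z_r` along `[z_l, z_r]`, carrying a certificate `(η, q)` that `z_r - z_l` lies
in the wave cone. Validity (weights, certificate, ambient set) is the separate predicate
`Laminate.IsValid`. [cite: ChoffrutSzekelyhidi2014, Def. 5] -/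
inductive Laminate : Type _
  | atom (w : State d) : Laminate
  | split (t : ℝ) (η : EuclideanSpace ℝ d) (q : ℝ) (l r : Laminate) : Laminate

namespace Laminate

variable {E : Type*} [AddCommGroup E] [Module ℝ E]

/-- Expectation of `f` under the laminate (`∫ f dν`). [cite: ChoffrutSzekelyhidi2014, Def. 5] -/
def moment (f : State d → E) : Laminate d → E
  | atom w => f w
  | split t _ _ l r => t • moment f l + (1 - t) • moment f r

/-- The barycentre `ν̄ = ∫ w dν(w)`. [cite: ChoffrutSzekelyhidi2014, Def. 5] -/
def bary (T : Laminate d) : State d := T.moment id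

/-- All atoms of the laminate satisfy `P` (`supp ν ⊆ {P}`). [cite: ChoffrutSzekelyhidi2014, Def. 5] -/
def AllAtoms (P : State d → Prop) : Laminate d → Prop
  | atom w => P w
  | split _ _ _ l r => AllAtoms P l ∧ AllAtoms P r

/-- All splitting weights lie in `[0, 1]` (so that the laminate is a probability measure).
[cite: ChoffrutSzekelyhidi2014, Def. 5] -/
def WeightsIn : Laminate d → Prop
  | atom _ => True
  | split t _ _ l r => 0 ≤ t ∧ t ≤ 1 ∧ WeightsIn l ∧ WeightsIn r

/-- **The class `𝓛(𝒰)`** (Def. 5): atoms lie in `𝒰`, weights lie in `[0, 1]`, every splitting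
segment `[z_l, z_r]` lies in `𝒰` and its direction `z_r - z_l` is certified to be in the wave
cone by `(η, q)`: `η ≠ 0`, `v̄ · η = 0`, `(ū + q Id) η = 0` ((3.1)).
[cite: ChoffrutSzekelyhidi2014, Def. 5] -/
def IsValid (U : Set (State d)) : Laminate d → Prop
  | atom w => w ∈ U
  | split t η q l r => 0 ≤ t ∧ t ≤ 1 ∧ η ≠ 0 ∧ ⟪vel (r.bary - l.bary), η⟫_ℝ = 0 ∧
      (str (r.bary - l.bary) + q • (1 : Matrix d d ℝ)) *ᵥ (⇑η) = 0 ∧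
      segment ℝ l.bary r.bary ⊆ U ∧ IsValid U l ∧ IsValid U r

section Moments

omit [Fintype d] [DecidableEq d]

/-- Expectation under a Dirac mass. [folklore] -/
@[simp] theorem moment_atom (f : State d → E) (w : State d) : (atom w).moment f = f w := rfl

/-- Expectation under a split laminate. [folklore] -/
@[simp] theorem moment_split (f : State d → E) (t : ℝ) (η : EuclideanSpace ℝ d) (q : ℝ)
    (l r : Laminate d) : (split t η q l r).moment f = t • l.moment f + (1 - t) • r.moment f := rfl

/-- Barycentre of a Dirac mass. [folklore] -/
@[simp] theorem bary_atom (w : State d) : (atom w).bary = w := rfl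

/-- Barycentre of a split laminate. [folklore] -/
theorem bary_split (t : ℝ) (η : EuclideanSpace ℝ d) (q : ℝ) (l r : Laminate d) :
    (split t η q l r).bary = t • l.bary + (1 - t) • r.bary := rfl

/-- Atoms predicate of a Dirac mass. [folklore] -/
@[simp] theorem allAtoms_atom (P : State d → Prop) (w : State d) : (atom w).AllAtoms P ↔ P w :=
  Iff.rfl

/-- Atoms predicate of a split laminate. [folklore] -/
@[simp] theorem allAtoms_split (P : State d → Prop) (t : ℝ) (η : EuclideanSpace ℝ d) (q : ℝ)
    (l r : Laminate d) : (split t η q l r).AllAtoms P ↔ l.AllAtoms P ∧ r.AllAtoms P := Iff.rfl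

/-- Laminates are probability measures: `∫ 1 dν = 1`. [folklore] -/
theorem moment_const (T : Laminate d) (c : E) : T.moment (fun _ => c) = c := by
  induction T with
  | atom w => rfl
  | split t η q l r ihl ihr => rw [moment_split, ihl, ihr, ← add_smul, add_sub_cancel, one_smul]

/-- Linearity of the expectation: sums. [folklore] -/
theorem moment_add (T : Laminate d) (f g : State d → E) :
    T.moment (fun w => f w + g w) = T.moment f + T.moment g := by
  induction T with
  | atom w => rfl
  | split t η q l r ihl ihr => simp only [moment_split, ihl, ihr, smul_add]; abel

/-- Linearity of the expectation: scalar multiples. [folklore] -/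
theorem moment_smul (T : Laminate d) (c : ℝ) (f : State d → E) :
    T.moment (fun w => c • f w) = c • T.moment f := by
  induction T with
  | atom w => rfl
  | split t η q l r ihl ihr => simp only [moment_split, ihl, ihr, smul_add, smul_comm c]

/-- Linearity of the expectation: differences. [folklore] -/
theorem moment_sub (T : Laminate d) (f g : State d → E) :
    T.moment (fun w => f w - g w) = T.moment f - T.moment g := by
  induction T with
  | atom w => rfl
  | split t η q l r ihl ihr => simp only [moment_split, ihl, ihr, smul_sub]; abel

/-- Linear maps commute with the expectation. [folklore] -/
theorem map_moment {F : Type*} [AddCommGroup F] [Module ℝ F] (L : E →ₗ[ℝ] F) (T : Laminate d)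
    (f : State d → E) : L (T.moment f) = T.moment (fun w => L (f w)) := by
  induction T with
  | atom w => rfl
  | split t η q l r ihl ihr => simp only [moment_split, map_add, map_smul, ihl, ihr]

/-- The expectation only depends on the values of `f` on the atoms. [folklore] -/
theorem moment_congr {T : Laminate d} {f g : State d → E} (h : T.AllAtoms fun w => f w = g w) :
    T.moment f = T.moment g := by
  induction T with
  | atom w => exact h
  | split t η q l r ihl ihr => rw [moment_split, moment_split, ihl h.1, ihr h.2]

/-- The expectation of a function constant on the atoms. [folklore] -/
theorem moment_eq_of_allAtoms {T : Laminate d} {f : State d → E} {c : E}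
    (h : T.AllAtoms fun w => f w = c) : T.moment f = c := by
  rw [moment_congr (g := fun _ => c) h, moment_const]

/-- Monotonicity of `AllAtoms`. [folklore] -/
theorem AllAtoms.mono {T : Laminate d} {P Q : State d → Prop} (h : T.AllAtoms P)
    (hPQ : ∀ w, P w → Q w) : T.AllAtoms Q := by
  induction T with
  | atom w => exact hPQ w h
  | split t η q l r ihl ihr => exact ⟨ihl h.1, ihr h.2⟩

/-- Conjunction of `AllAtoms`. [folklore] -/
theorem AllAtoms.and {T : Laminate d} {P Q : State d → Prop} (hP : T.AllAtoms P)
    (hQ : T.AllAtoms Q) : T.AllAtoms fun w => P w ∧ Q w := by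
  induction T with
  | atom w => exact ⟨hP, hQ⟩
  | split t η q l r ihl ihr => exact ⟨ihl hP.1 hQ.1, ihr hP.2 hQ.2⟩

/-- A property holding everywhere holds on all atoms. [folklore] -/
theorem allAtoms_of_forall {P : State d → Prop} (h : ∀ w, P w) (T : Laminate d) : T.AllAtoms P := by
  induction T with
  | atom w => exact h w
  | split t η q l r ihl ihr => exact ⟨ihl, ihr⟩

/-- Expectations of nonnegative functions are nonnegative. [folklore] -/
theorem moment_nonneg {T : Laminate d} (hT : T.WeightsIn) {f : State d → ℝ}
    (hf : T.AllAtoms fun w => 0 ≤ f w) : 0 ≤ T.moment f := by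
  induction T with
  | atom w => exact hf
  | split t η q l r ihl ihr =>
    rw [moment_split]
    exact add_nonneg (smul_nonneg hT.1 (ihl hT.2.2.1 hf.1))
      (smul_nonneg (by linarith [hT.2.1]) (ihr hT.2.2.2 hf.2))

/-- Monotonicity of the expectation. [folklore] -/
theorem moment_mono {T : Laminate d} (hT : T.WeightsIn) {f g : State d → ℝ}
    (h : T.AllAtoms fun w => f w ≤ g w) : T.moment f ≤ T.moment g := by
  have := moment_nonneg hT (f := fun w => g w - f w) (h.mono fun w hw => sub_nonneg.2 hw)
  rw [moment_sub] at this
  linarith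

/-- The barycentre is the first moment. [folklore] -/
theorem moment_id (T : Laminate d) : T.moment id = T.bary := rfl

/-- First moments of affine images: `∫ (w - a) dν = ν̄ - a`. [folklore] -/
theorem moment_sub_const (T : Laminate d) (a : State d) :
    T.moment (fun w => w - a) = T.bary - a := by
  have h := moment_sub T id (fun _ => a)
  rw [moment_const] at h
  exact h

end Moments

/-! ### Inner products, variance, parallel axis -/

section Variance

omit [DecidableEq d]

/-- Inner products with a fixed vector commute with the expectation. [folklore] -/
theorem moment_inner_left (T : Laminate d) (g : State d → State d) (c : State d) :
    T.moment (fun w => ⟪g w, c⟫_ℝ) = ⟪T.moment g, c⟫_ℝ := by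
  induction T with
  | atom w => rfl
  | split t η q l r ihl ihr =>
    simp only [moment_split, ihl, ihr, inner_add_left, inner_smul_left, smul_eq_mul, RCLike.conj_to_real]

/-- The variance `∫ ‖w - a‖² dν(w)` of the laminate about the point `a`. [cite: ChoffrutSzekelyhidi2014, Prop. 7] -/
def var (a : State d) (T : Laminate d) : ℝ := T.moment fun w => ‖w - a‖ ^ 2

/-- Variance of a Dirac mass. [folklore] -/
@[simp] theorem var_atom (a w : State d) : (atom w).var a = ‖w - a‖ ^ 2 := rfl

/-- Variance of a split laminate (same centre). [folklore] -/
theorem var_split (a : State d) (t : ℝ) (η : EuclideanSpace ℝ d) (q : ℝ) (l r : Laminate d) :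
    (split t η q l r).var a = t * l.var a + (1 - t) * r.var a := rfl

/-- **Parallel axis theorem**: `∫ ‖w - a‖² dν = ∫ ‖w - ν̄‖² dν + ‖ν̄ - a‖²`. [folklore] -/
theorem var_eq_var_bary_add (T : Laminate d) (a : State d) :
    T.var a = T.var T.bary + ‖T.bary - a‖ ^ 2 := by
  have key : ∀ w, ‖w - a‖ ^ 2 =
      ‖w - T.bary‖ ^ 2 + (2 : ℝ) • ⟪w - T.bary, T.bary - a⟫_ℝ + ‖T.bary - a‖ ^ 2 := by
    intro w
    have : w - a = (w - T.bary) + (T.bary - a) := by abel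
    rw [this, norm_add_sq_real]; simp [smul_eq_mul]
  unfold var
  rw [show (fun w => ‖w - a‖ ^ 2) = fun w =>
      (‖w - T.bary‖ ^ 2 + (2 : ℝ) • ⟪w - T.bary, T.bary - a⟫_ℝ) + ‖T.bary - a‖ ^ 2 from funext key,
    moment_add, moment_const, moment_add, moment_smul, moment_inner_left, moment_sub_const,
    sub_self, inner_zero_left, smul_zero, add_zero]

/-- The variance is nonnegative. [folklore] -/
theorem var_nonneg {T : Laminate d} (hT : T.WeightsIn) (a : State d) : 0 ≤ T.var a :=
  moment_nonneg hT (allAtoms_of_forall (fun _ => sq_nonneg _) T)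

/-- The velocity part of the variance is dominated by the variance. [folklore] -/
theorem moment_vel_le_var {T : Laminate d} (hT : T.WeightsIn) (a : State d) :
    T.moment (fun w => ‖vel w - vel a‖ ^ 2) ≤ T.var a := by
  refine moment_mono hT (allAtoms_of_forall (fun w => ?_) T)
  rw [← vel_sub]
  exact pow_le_pow_left₀ (norm_nonneg _) (norm_vel_le _) 2

/-- Parallel axis for the velocity part: `∫ |v - v̄|² dν = ∫ |v|² dν - |v̄|²`. [folklore] -/
theorem moment_vel_sub_sq (T : Laminate d) :
    T.moment (fun w => ‖vel w - vel T.bary‖ ^ 2) = T.moment (fun w => ‖vel w‖ ^ 2) - ‖vel T.bary‖ ^ 2 := by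
  set b := vel T.bary
  have key : ∀ w, ‖vel w - b‖ ^ 2 = ‖vel w‖ ^ 2 - (2 : ℝ) • ⟪vel w, b⟫_ℝ + ‖b‖ ^ 2 := by
    intro w; rw [norm_sub_sq_real]; simp [smul_eq_mul]
  have h1 : (fun w : State d => ⟪vel w, b⟫_ℝ) = fun w => ⟪id w, mkSt b 0⟫_ℝ := by
    funext w
    simp only [PiLp.inner_apply, RCLike.inner_apply, conj_trivial, Fintype.sum_sum_type,
      mkSt_apply_inl, mkSt_apply_inr, vel_apply, Matrix.zero_apply, zero_mul, Finset.sum_const_zero,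
      add_zero, id]
  have hlin : T.moment (fun w => ⟪vel w, b⟫_ℝ) = ‖b‖ ^ 2 := by
    have h2 := congrFun h1 T.bary
    rw [h1, moment_inner_left T id (mkSt b 0), moment_id, ← real_inner_self_eq_norm_sq]
    exact h2.symm
  rw [show (fun w => ‖vel w - b‖ ^ 2) = fun w =>
      (‖vel w‖ ^ 2 - (2 : ℝ) • ⟪vel w, b⟫_ℝ) + ‖b‖ ^ 2 from funext key,
    moment_add, moment_const, moment_sub, moment_smul, hlin]
  simp only [smul_eq_mul]; ring

end Variance

/-- **The gain of a laminate supported on `𝒦_{r'}`** (proof of Cor. 16 of the paper):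
if all atoms lie in `𝒦_{r'}`, then `∫ ‖w - ν̄‖² dν ≥ ∫ |v - v̄|² dν = r' - |v̄|²`.
[cite: ChoffrutSzekelyhidi2014, Cor. 16 (proof)] -/
theorem sub_norm_vel_sq_le_var {T : Laminate d} (hT : T.WeightsIn) {r' : ℝ}
    (hK : T.AllAtoms (· ∈ K r')) : r' - ‖vel T.bary‖ ^ 2 ≤ T.var T.bary := by
  have h1 : T.moment (fun w => ‖vel w‖ ^ 2) = r' :=
    moment_eq_of_allAtoms (hK.mono fun w hw => hw.1)
  have h2 := moment_vel_sub_sq T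
  rw [h1] at h2
  linarith [moment_vel_le_var hT T.bary]


/-! ### Validity -/

section Valid

variable {U U' : Set (State d)}

/-- Valid laminates have weights in `[0, 1]`. [folklore] -/
theorem IsValid.weightsIn {T : Laminate d} (h : T.IsValid U) : T.WeightsIn := by
  induction T with
  | atom w => trivial
  | split t η q l r ihl ihr => exact ⟨h.1, h.2.1, ihl h.2.2.2.2.2.2.1, ihr h.2.2.2.2.2.2.2⟩

/-- Atoms of a valid laminate lie in the ambient set. [folklore] -/
theorem IsValid.allAtoms_mem {T : Laminate d} (h : T.IsValid U) : T.AllAtoms (· ∈ U) := by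
  induction T with
  | atom w => exact h
  | split t η q l r ihl ihr => exact ⟨ihl h.2.2.2.2.2.2.1, ihr h.2.2.2.2.2.2.2⟩

/-- The barycentre of a valid laminate lies in the ambient set (it lies on the top splitting
segment). [cite: ChoffrutSzekelyhidi2014, Def. 5] -/
theorem IsValid.bary_mem {T : Laminate d} (h : T.IsValid U) : T.bary ∈ U := by
  cases T with
  | atom w => exact h
  | split t η q l r =>
    refine h.2.2.2.2.2.1 ⟨t, 1 - t, h.1, by linarith [h.2.1], by ring, ?_⟩
    rfl

/-- Validity is monotone in the ambient set. [folklore] -/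
theorem IsValid.mono {T : Laminate d} (h : T.IsValid U) (hUU' : U ⊆ U') : T.IsValid U' := by
  induction T with
  | atom w => exact hUU' h
  | split t η q l r ihl ihr =>
    exact ⟨h.1, h.2.1, h.2.2.1, h.2.2.2.1, h.2.2.2.2.1, h.2.2.2.2.2.1.trans hUU',
      ihl h.2.2.2.2.2.2.1, ihr h.2.2.2.2.2.2.2⟩

/-- The top splitting direction of a valid laminate lies in the wave cone. [cite: ChoffrutSzekelyhidi2014, Def. 5] -/
theorem IsValid.isWaveDir {t : ℝ} {η : EuclideanSpace ℝ d} {q : ℝ} {l r : Laminate d}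
    (h : (split t η q l r).IsValid U) : IsWaveDir (r.bary - l.bary) :=
  ⟨η, q, h.2.2.1, h.2.2.2.1, h.2.2.2.2.1⟩

omit [DecidableEq d] in
/-- Barycentres of laminates with admissible atoms are admissible. [folklore] -/
theorem isAdm_bary {T : Laminate d} (h : T.AllAtoms IsAdm) : IsAdm T.bary := by
  induction T with
  | atom w => exact h
  | split t η q l r ihl ihr => exact ((ihl h.1).smul t).add ((ihr h.2).smul (1 - t))

end Valid

/-! ### Grafting laminates onto atoms ("closed under splitting") -/

section Bind

/-- Replace every atom `w` by the laminate `g w` (iterated splitting of atoms, Def. 5).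
[cite: ChoffrutSzekelyhidi2014, Def. 5] -/
def bind (g : State d → Laminate d) : Laminate d → Laminate d
  | atom w => g w
  | split t η q l r => split t η q (bind g l) (bind g r)

variable {E : Type*} [AddCommGroup E] [Module ℝ E]

omit [Fintype d] [DecidableEq d] in
/-- Expectations under a grafted laminate (tower property). [folklore] -/
theorem moment_bind (g : State d → Laminate d) (T : Laminate d) (f : State d → E) :
    (T.bind g).moment f = T.moment fun w => (g w).moment f := by
  induction T with
  | atom w => rfl
  | split t η q l r ihl ihr => simp only [bind, moment_split, ihl, ihr]

omit [Fintype d] [DecidableEq d] in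
/-- Grafting barycentre-preserving laminates does not move the barycentre. [folklore] -/
theorem bary_bind {g : State d → Laminate d} {T : Laminate d}
    (h : T.AllAtoms fun w => (g w).bary = w) : (T.bind g).bary = T.bary := by
  rw [bary, moment_bind]
  exact moment_congr (f := fun w => (g w).moment id) (g := id) h

omit [Fintype d] [DecidableEq d] in
/-- Atoms of a grafted laminate. [folklore] -/
theorem allAtoms_bind {P : State d → Prop} {g : State d → Laminate d} {T : Laminate d}
    (h : T.AllAtoms fun w => (g w).AllAtoms P) : (T.bind g).AllAtoms P := by
  induction T with
  | atom w => exact h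
  | split t η q l r ihl ihr => exact ⟨ihl h.1, ihr h.2⟩

/-- **`𝓛(𝒰)` is closed under splitting of atoms**: grafting valid, barycentre-preserving
laminates onto the atoms of a valid laminate gives a valid laminate. [cite: ChoffrutSzekelyhidi2014, Def. 5] -/
theorem isValid_bind {U : Set (State d)} {g : State d → Laminate d} {T : Laminate d}
    (hT : T.IsValid U) (hg : T.AllAtoms fun w => (g w).IsValid U ∧ (g w).bary = w) :
    (T.bind g).IsValid U := by
  induction T with
  | atom w => exact hg.1
  | split t η q l r ihl ihr =>
    have hl : (l.bind g).bary = l.bary := bary_bind (hg.1.mono fun w hw => hw.2)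
    have hr : (r.bind g).bary = r.bary := bary_bind (hg.2.mono fun w hw => hw.2)
    refine ⟨hT.1, hT.2.1, hT.2.2.1, ?_, ?_, ?_, ihl hT.2.2.2.2.2.2.1 hg.1, ihr hT.2.2.2.2.2.2.2 hg.2⟩
    · rw [hl, hr]; exact hT.2.2.2.1
    · rw [hl, hr]; exact hT.2.2.2.2.1
    · rw [hl, hr]; exact hT.2.2.2.2.2.1

end Bind

end Laminate

/-! ## The lamination convex hull and Lemma 9 -/

section Hull

/-- One step of the lamination-convex hull: add all segments between points of `U` whose
difference lies in the wave cone (`𝒰⁽ⁱ⁺¹⁾` from `𝒰⁽ⁱ⁾`, Def. 8). [cite: ChoffrutSzekelyhidi2014, Def. 8] -/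
def lcSucc (U : Set (State d)) : Set (State d) :=
  U ∪ {x | ∃ ξ ∈ U, ∃ ξ' ∈ U, IsWaveDir (ξ' - ξ) ∧ x ∈ segment ℝ ξ ξ'}

/-- The iterates `𝒰⁽ⁿ⁾` of Def. 8. [cite: ChoffrutSzekelyhidi2014, Def. 8] -/
def lcIter (U : Set (State d)) : ℕ → Set (State d)
  | 0 => U
  | n + 1 => lcSucc (lcIter U n)

/-- The lamination convex hull `𝒰^{lc} = ⋃ₙ 𝒰⁽ⁿ⁾` with respect to the stationary wave cone.
[cite: ChoffrutSzekelyhidi2014, Def. 8] -/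
def lcHull (U : Set (State d)) : Set (State d) := ⋃ n, lcIter U n

variable {U : Set (State d)}

/-- `𝒰 ⊆ 𝒰⁽¹⁾`. [folklore] -/
theorem subset_lcSucc (U : Set (State d)) : U ⊆ lcSucc U := Set.subset_union_left

/-- `𝒰⁽ⁿ⁾ ⊆ 𝒰⁽ⁿ⁺¹⁾`. [folklore] -/
theorem lcIter_subset_succ (U : Set (State d)) (n : ℕ) : lcIter U n ⊆ lcIter U (n + 1) :=
  subset_lcSucc _

/-- The iterates increase. [folklore] -/
theorem lcIter_mono (U : Set (State d)) : Monotone (lcIter U) :=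
  monotone_nat_of_le_succ (lcIter_subset_succ U)

/-- `𝒰⁽ⁿ⁾ ⊆ 𝒰^{lc}`. [folklore] -/
theorem lcIter_subset_lcHull (U : Set (State d)) (n : ℕ) : lcIter U n ⊆ lcHull U :=
  Set.subset_iUnion (lcIter U) n

/-- `𝒰 ⊆ 𝒰^{lc}`. [cite: ChoffrutSzekelyhidi2014, Def. 8] -/
theorem subset_lcHull (U : Set (State d)) : U ⊆ lcHull U := lcIter_subset_lcHull U 0

/-- The hull is lamination convex: it contains every wave-cone segment between its points.
[cite: ChoffrutSzekelyhidi2014, Def. 8] -/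
theorem segment_subset_lcHull {ξ ξ' : State d} (hξ : ξ ∈ lcHull U) (hξ' : ξ' ∈ lcHull U)
    (hw : IsWaveDir (ξ' - ξ)) : segment ℝ ξ ξ' ⊆ lcHull U := by
  obtain ⟨n, hn⟩ := Set.mem_iUnion.1 hξ
  obtain ⟨m, hm⟩ := Set.mem_iUnion.1 hξ'
  intro x hx
  refine Set.mem_iUnion.2 ⟨max n m + 1, Or.inr ⟨ξ, lcIter_mono U (le_max_left n m) hn, ξ',
    lcIter_mono U (le_max_right n m) hm, hw, hx⟩⟩

/-- The hull of a subset of a convex set stays inside (in particular `𝒰^{lc} ⊆ 𝒰^{co}`).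
[cite: ChoffrutSzekelyhidi2014, Def. 8] -/
theorem lcHull_subset_of_convex {C : Set (State d)} (hC : Convex ℝ C) (hU : U ⊆ C) :
    lcHull U ⊆ C := by
  refine Set.iUnion_subset fun n => ?_
  induction n with
  | zero => exact hU
  | succ n ih =>
    rintro x (hx | ⟨ξ, hξ, ξ', hξ', -, hx⟩)
    · exact ih hx
    · exact hC.segment_subset (ih hξ) (ih hξ') hx

omit [DecidableEq d] in
/-- Segments between admissible states are admissible. [folklore] -/
theorem segment_subset_Adm {ξ ξ' : State d} (hξ : IsAdm ξ) (hξ' : IsAdm ξ') :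
    segment ℝ ξ ξ' ⊆ Adm := convex_Adm.segment_subset hξ hξ'

/-- One hull step preserves relative openness (proof of Lemma 9: translate both endpoints).
[cite: ChoffrutSzekelyhidi2014, Lemma 9] -/
theorem isRelOpen_lcSucc (hA : U ⊆ Adm) (hU : IsRelOpen U) : IsRelOpen (lcSucc U) := by
  rintro x (hx | ⟨ξ, hξ, ξ', hξ', hw, hx⟩)
  · obtain ⟨ε, hε, h⟩ := hU x hx
    exact ⟨ε, hε, fun w' hw' hd => subset_lcSucc U (h w' hw' hd)⟩
  · obtain ⟨ε₁, hε₁, h₁⟩ := hU ξ hξ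
    obtain ⟨ε₂, hε₂, h₂⟩ := hU ξ' hξ'
    refine ⟨min ε₁ ε₂, lt_min hε₁ hε₂, fun w' hw' hd => ?_⟩
    set z := w' - x with hz
    have hzadm : IsAdm z := hw'.sub (segment_subset_Adm (hA hξ) (hA hξ') hx)
    have hzn : ‖z‖ < min ε₁ ε₂ := by rwa [hz, ← dist_eq_norm]
    refine Or.inr ⟨ξ + z, h₁ _ ((hA hξ).add hzadm) ?_, ξ' + z, h₂ _ ((hA hξ').add hzadm) ?_, ?_, ?_⟩
    · rw [dist_eq_norm, add_sub_cancel_left]; exact hzn.trans_le (min_le_left _ _)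
    · rw [dist_eq_norm, add_sub_cancel_left]; exact hzn.trans_le (min_le_right _ _)
    · simpa using hw
    · obtain ⟨a, b, ha, hb, hab, rfl⟩ := hx
      refine ⟨a, b, ha, hb, hab, ?_⟩
      rw [hz]
      simp only [smul_add]
      rw [show a • ξ + a • (w' - (a • ξ + b • ξ')) + (b • ξ' + b • (w' - (a • ξ + b • ξ'))) =
        (a • ξ + b • ξ') + (a + b) • (w' - (a • ξ + b • ξ')) by rw [add_smul]; abel, hab, one_smul]
      abel

/-- The hull of a set of admissible states consists of admissible states. [folklore] -/
theorem lcHull_subset_Adm (hA : U ⊆ Adm) : lcHull U ⊆ Adm := lcHull_subset_of_convex convex_Adm hA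

/-- Each iterate of a set of admissible states consists of admissible states. [folklore] -/
theorem lcIter_subset_Adm (hA : U ⊆ Adm) (n : ℕ) : lcIter U n ⊆ Adm :=
  (lcIter_subset_lcHull U n).trans (lcHull_subset_Adm hA)

/-- **Lemma 9 (openness).** The lamination convex hull of a relatively open set of admissible
states is relatively open. [cite: ChoffrutSzekelyhidi2014, Lemma 9] -/
theorem isRelOpen_lcHull (hA : U ⊆ Adm) (hU : IsRelOpen U) : IsRelOpen (lcHull U) := by
  have hn : ∀ n, IsRelOpen (lcIter U n) := by
    intro n
    induction n with
    | zero => exact hU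
    | succ n ih => exact isRelOpen_lcSucc (lcIter_subset_Adm hA n) ih
  intro x hx
  obtain ⟨n, hxn⟩ := Set.mem_iUnion.1 hx
  obtain ⟨ε, hε, h⟩ := hn n x hxn
  exact ⟨ε, hε, fun w' hw' hd => lcIter_subset_lcHull U n (h w' hw' hd)⟩

/-- **Lemma 9 (laminates).** Every point of `𝒰^{lc}` is the barycentre of a laminate of finite
order in `𝓛(𝒰^{lc})` whose atoms lie in `𝒰`. [cite: ChoffrutSzekelyhidi2014, Lemma 9] -/
theorem exists_laminate_of_mem_lcHull {x : State d} (hx : x ∈ lcHull U) :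
    ∃ T : Laminate d, T.IsValid (lcHull U) ∧ T.bary = x ∧ T.AllAtoms (· ∈ U) := by
  obtain ⟨n, hxn⟩ := Set.mem_iUnion.1 hx
  clear hx
  induction n generalizing x with
  | zero => exact ⟨Laminate.atom x, subset_lcHull U hxn, rfl, hxn⟩
  | succ n ih =>
    rcases hxn with hxn | ⟨ξ, hξ, ξ', hξ', hw, hxs⟩
    · exact ih hxn
    · obtain ⟨Tl, hTl, hbl, hal⟩ := ih hξ
      obtain ⟨Tr, hTr, hbr, har⟩ := ih hξ'
      obtain ⟨η, q, hη, hv, hu⟩ := hw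
      obtain ⟨a, b, ha, hb, hab, rfl⟩ := hxs
      refine ⟨Laminate.split a η q Tl Tr, ⟨ha, by linarith, hη, ?_, ?_, ?_, hTl, hTr⟩, ?_,
        ⟨hal, har⟩⟩
      · rw [hbl, hbr]; exact hv
      · rw [hbl, hbr]; exact hu
      · rw [hbl, hbr]
        exact segment_subset_lcHull (lcIter_subset_lcHull U n hξ) (lcIter_subset_lcHull U n hξ')
          ⟨η, q, hη, hv, hu⟩
      · rw [Laminate.bary_split, hbl, hbr, show b = 1 - a by linarith]

end Hull

/-! ## The interface to the analytic part -/

variable (d) in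
/-- **A family of relaxed sets with the laminate property** — the common output of §4
(`d ≥ 3`, `𝒰_r = int 𝒦_r^{co}`) and §5 (`d = 2`, `𝒰_r = 𝒱_r^{lc}`) of the paper and the only
geometric input of the convex-integration scheme: relatively open (jointly in `(r, w)`) sets
`𝒰_r ⊆ 𝒦_r^{co}` of admissible states with property (*) `𝒦_{r'} ⊆ 𝒰_r` for `0 ≤ r' < r`
(so that smooth strict subsolutions take values in `𝒰`, Step 2 of the proof of Thm. 1) and the
laminate property of Prop. 15 (iii): every `w ∈ 𝒰_r` is the barycentre of a laminate of finite
order in `𝓛(𝒰_r)` supported in `𝒦_{r'}` for some `r' ∈ (r - ε, r)`; by Prop. 7 and the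
computation of Cor. 16 this yields the perturbation property (P).
[cite: ChoffrutSzekelyhidi2014, §2 (P), (*); Prop. 7; Prop. 15 (iii); Cor. 12; Cor. 16] -/
structure RelaxedFamily where
  /-- the relaxed sets `𝒰_r` -/
  U : ℝ → Set (State d)
  /-- `𝒰_r ⊆ 𝒦_r^{co}` -/
  subset_C : ∀ r, U r ⊆ C r
  /-- `{(r, w) : w ∈ 𝒰_r}` is open relatively to admissible states -/
  relOpen : ∀ r w, w ∈ U r → ∃ ε > 0, ∀ r' w', |r' - r| < ε → IsAdm w' → dist w' w < ε → w' ∈ U r'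
  /-- property (*): `𝒦_{r'} ⊆ 𝒰_r` for `0 ≤ r' < r` -/
  K_subset : ∀ ⦃r r' : ℝ⦄, 0 ≤ r' → r' < r → K r' ⊆ U r
  /-- the laminate property (Prop. 15 (iii)) -/
  laminate : ∀ ⦃r : ℝ⦄ ⦃w : State d⦄, w ∈ U r → ∀ ε > 0, ∃ r', r - ε < r' ∧ r' < r ∧ 0 ≤ r' ∧
    ∃ T : Laminate d, T.IsValid (U r) ∧ T.bary = w ∧ T.AllAtoms (· ∈ K r')

namespace RelaxedFamily

variable (𝓕 : RelaxedFamily d)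

/-- The relaxed sets consist of admissible states. [folklore] -/
theorem isAdm_of_mem {r : ℝ} {w : State d} (hw : w ∈ 𝓕.U r) : IsAdm w := (𝓕.subset_C r hw).1

/-- Each `𝒰_r` is relatively open. [folklore] -/
theorem isRelOpen (r : ℝ) : IsRelOpen (𝓕.U r) := by
  intro w hw
  obtain ⟨ε, hε, h⟩ := 𝓕.relOpen r w hw
  exact ⟨ε, hε, fun w' hw' hd => h r w' (by simpa using hε) hw' hd⟩

/-- `0 ∈ 𝒰_r` for `r > 0` (`𝒦_0 = {0}`). [folklore] -/
theorem zero_mem {r : ℝ} (hr : 0 < r) : (0 : State d) ∈ 𝓕.U r := by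
  refine 𝓕.K_subset le_rfl hr ⟨by simp, ?_⟩
  rw [vel_zero, str_zero, zero_div, zero_smul, sub_zero]
  ext i j
  simp [Matrix.vecMulVec_apply]

/-- **The gain of the laminate property** (Cor. 16): every `w ∈ 𝒰_r` is, for every `ε > 0`, the
barycentre of a laminate in `𝓛(𝒰_r)` with variance at least `r - ε - |v̄|²`, supported in some
`𝒦_{r'}`, `r' ∈ (r - ε, r)`. [cite: ChoffrutSzekelyhidi2014, Cor. 16] -/
theorem exists_laminate_var_ge {r : ℝ} {w : State d} (hw : w ∈ 𝓕.U r) {ε : ℝ} (hε : 0 < ε) :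
    ∃ r', r - ε < r' ∧ r' < r ∧ 0 ≤ r' ∧ ∃ T : Laminate d, T.IsValid (𝓕.U r) ∧ T.bary = w ∧
      T.AllAtoms (· ∈ K r') ∧ r - ε - ‖vel w‖ ^ 2 ≤ T.var w := by
  obtain ⟨r', h1, h2, h3, T, hT, hb, hK⟩ := 𝓕.laminate hw ε hε
  refine ⟨r', h1, h2, h3, T, hT, hb, hK, ?_⟩
  have := Laminate.sub_norm_vel_sq_le_var hT.weightsIn hK
  rw [hb] at this
  linarith

end RelaxedFamily

end StationaryEuler

end Literature.Analysis.FluidPDE
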